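import Literature.Barriers.RiemannHypothesis.FeketePolyaPositivityLaplaceProofs
import Mathlib.MeasureTheory.Integral.IntegralEqImproper
import HarnessLib

/-!
# The Fekete–Pólya criterion with a positive finite Euler-type reweighting

Topic `Literature/NumberTheory/LFunctions`; namespace `Literature.NumberTheory.LFunctions.FeketePolyaReweighted`.
THEOREMS (no definition beyond the reweighted sequence, no named fact, no `sorry`). Montgomery–Vaughan §11.2.1
Exercise 7 (g) proves `L(σ, χ) > 0` on `σ > 0` from the non-negativity of an iterated summatory function of `χ`
itself; Exercise 8 (Chowla, Rosser's device) applies it to an INDUCED character `χ↑m`, i.e. to the coefficients of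
`L(s, χ)·∏_{p ∣ m}(1 − χ(p)p^{−s})`. Here is the common generalisation the kernel certificates of
`FeketePolyaKernelCertificatesReweighted*.lean` use: for a finite list of pairs `(d, c_d)` (`d ≥ 1`) put
`a(n) = Σ_{(d, c_d)} c_d·[d ∣ n]·ℜχ(n/d)` — the coefficients of `L(s, χ)·G(s)`, `G(s) = Σ c_d d^{−s}` — and
suppose `G(σ) > 0`. If some iterated summatory function `S_k(N, a)` is `≥ 0` for all `N ≥ 1` (and `a(1) > 0`),
then `ℜL(σ, χ) > 0` (`re_LFunction_pos_of_reweighted`). Examples: `G = ∏_{p ∈ S}(1 + ε_p p^{−s})` with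
`ε_p ∈ {−χ(p), +χ(p)}` for `p ∤ q` (remove / double the multiples of `p`) and `ε_p = ±1` for `p ∣ q` — every
factor lies in `(0, 2)` for real `s > 0`.

Proof (real axis only; everything after MV (5.23) is the tree's `FeketePolyaPositivityLaplaceProofs`):
`Γ(σ)·ℜL(σ, χ) = ∫₀^∞ t^{σ−1} P_χ(e^{−t}) dt` (`Gamma_mul_re_LFunction_eq_integral`), the substitution
`t ↦ dt` gives `∫₀^∞ t^{σ−1} P_χ(e^{−dt}) dt = d^{−σ} Γ(σ) ℜL(σ, χ)`, and `P_a(e^{−t}) = Σ c_d P_χ(e^{−dt})`;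
so `∫₀^∞ t^{σ−1} P_a(e^{−t}) dt = Γ(σ) G(σ) ℜL(σ, χ)`, while the left side is `> 0` by
`integral_rpow_mul_powerSeries_pos` (non-negative iterated sums ⇒ `P_a > 0` on `(0,1)`).

## References

* H. L. Montgomery, R. C. Vaughan, *Multiplicative Number Theory I*, CUP 2007, §5.1 eq. (5.23), §11.2.1
  Exercises 7 (g), (i), (j) and 8. [MontgomeryVaughan2007]
* J. B. Rosser, *Real roots of real Dirichlet L-series*, J. Res. NBS 45 (1950) 505–514. [Rosser1950RealRoots]
-/

noncomputable section

open Finset Filter MeasureTheory Set Literature.Barriers.RiemannHypothesis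

namespace Literature.NumberTheory.LFunctions

namespace FeketePolyaReweighted

variable {q : ℕ} [NeZero q] (χ : DirichletCharacter ℂ q)

/-- **The reweighted sequence** `a(n) = Σ_{(d, c) ∈ tw} c·[d ∣ n]·ℜχ(n/d)` — the Dirichlet coefficients of
`L(s, χ)·Σ_{(d,c)} c d^{−s}`. [cite: MontgomeryVaughan2007, §11.2.1 Exercise 8] -/
def rwSeq (tw : List (ℕ × ℤ)) (n : ℕ) : ℝ :=
  (tw.map fun dc => if dc.1 ∣ n then (dc.2 : ℝ) * (χ ((n / dc.1 : ℕ) : ZMod q)).re else 0).sum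

/-- The Euler-type factor `G(σ) = Σ_{(d,c)} c·d^{−σ}`. [cite: MontgomeryVaughan2007, §11.2.1 Exercise 8] -/
def rwG (tw : List (ℕ × ℤ)) (σ : ℝ) : ℝ := (tw.map fun dc => (dc.2 : ℝ) * (dc.1 : ℝ) ^ (-σ)).sum

/-! ### Linearity of the summatory functions -/

omit [NeZero q] in
/-- `S(f / C) = S(f)/C`. [folklore] -/
private theorem summatory_div (f : ℕ → ℝ) (C : ℝ) (N : ℕ) :
    summatory (fun n ↦ f n / C) N = summatory f N / C := by
  simp [summatory, Finset.sum_div]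

omit [NeZero q] in
/-- `S_k(f / C) = S_k(f)/C`. [folklore] -/
private theorem iterSummatory_div (f : ℕ → ℝ) (C : ℝ) : ∀ (k N : ℕ),
    iterSummatory (fun n ↦ f n / C) k N = iterSummatory f k N / C
  | 0, N => rfl
  | k + 1, N => by
    rw [iterSummatory_succ, iterSummatory_succ, summatory, summatory, Finset.sum_div]
    exact Finset.sum_congr rfl fun n _ ↦ iterSummatory_div f C k n

/-! ### The power series of the reweighted sequence -/

/-- One term of the reweighted sequence against `zⁿ`. [folklore] -/
private def termZ (z : ℝ) (dc : ℕ × ℤ) (n : ℕ) : ℝ :=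
  (if dc.1 ∣ n then (dc.2 : ℝ) * (χ ((n / dc.1 : ℕ) : ZMod q)).re else 0) * z ^ n

omit [NeZero q] in
/-- `|term| ≤ |c| zⁿ`, hence summable for `0 ≤ z < 1`. [folklore] -/
private theorem summable_termZ {z : ℝ} (hz0 : 0 ≤ z) (hz1 : z < 1) (dc : ℕ × ℤ) :
    Summable (termZ χ z dc) := by
  refine Summable.of_norm_bounded (g := fun n ↦ |(dc.2 : ℝ)| * z ^ n)
    ((summable_geometric_of_lt_one hz0 hz1).mul_left _) fun n ↦ ?_
  rw [termZ, Real.norm_eq_abs, abs_mul, abs_of_nonneg (pow_nonneg hz0 n)]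
  refine mul_le_mul_of_nonneg_right ?_ (pow_nonneg hz0 n)
  split_ifs
  · rw [abs_mul]
    exact mul_le_of_le_one_right (abs_nonneg _) (abs_re_apply_natCast_le χ _)
  · simp

omit [NeZero q] in
/-- The `d`-dilated series: `Σ_n [d ∣ n] c ℜχ(n/d) zⁿ = c Σ_m ℜχ(m) z^{dm}` (`d ≥ 1`). [folklore] -/
private theorem tsum_termZ {z : ℝ} (dc : ℕ × ℤ) (hd : 1 ≤ dc.1) :
    ∑' n, termZ χ z dc n = (dc.2 : ℝ) * ∑' m : ℕ, (χ ((m : ℕ) : ZMod q)).re * (z ^ dc.1) ^ m := by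
  have hinj : Function.Injective fun m : ℕ ↦ dc.1 * m := fun a b h ↦ by
    simpa [Nat.mul_right_inj (show dc.1 ≠ 0 by omega)] using h
  have hsupp : Function.support (termZ χ z dc) ⊆ Set.range fun m : ℕ ↦ dc.1 * m := by
    intro n hn
    rw [Function.mem_support, termZ] at hn
    by_cases h : dc.1 ∣ n
    · obtain ⟨m, rfl⟩ := h; exact ⟨m, rfl⟩
    · simp [h] at hn
  rw [← hinj.tsum_eq hsupp, ← tsum_mul_left]
  refine tsum_congr fun m ↦ ?_
  simp only [termZ, Nat.dvd_mul_right, if_true, Nat.mul_div_cancel_left m (by omega : 0 < dc.1), pow_mul]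
  ring

omit [NeZero q] in
/-- Summability of `Σ a(n) zⁿ` for `0 ≤ z < 1`. [folklore] -/
private theorem summable_rwSeq_mul_pow {z : ℝ} (hz0 : 0 ≤ z) (hz1 : z < 1) :
    ∀ tw : List (ℕ × ℤ), Summable fun n ↦ rwSeq χ tw n * z ^ n
  | [] => by simp only [rwSeq, List.map_nil, List.sum_nil, zero_mul]; exact summable_zero
  | dc :: rest => by
    have : (fun n ↦ rwSeq χ (dc :: rest) n * z ^ n) = fun n ↦ termZ χ z dc n + rwSeq χ rest n * z ^ n := by
      funext n; simp only [rwSeq, List.map_cons, List.sum_cons, termZ]; ring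
    rw [this]
    exact (summable_termZ χ hz0 hz1 dc).add (summable_rwSeq_mul_pow hz0 hz1 rest)

omit [NeZero q] in
/-- The power series of `a` is the finite combination of dilated power series of `ℜχ`:
`Σ_n a(n) zⁿ = Σ_{(d,c)} c Σ_m ℜχ(m) (z^d)^m` (`0 ≤ z < 1`). [cite: MontgomeryVaughan2007, §11.2.1 Exercise 7 (i)] -/
theorem tsum_rwSeq_mul_pow {z : ℝ} (hz0 : 0 ≤ z) (hz1 : z < 1) :
    ∀ tw : List (ℕ × ℤ), (∀ dc ∈ tw, 1 ≤ dc.1) →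
    ∑' n, rwSeq χ tw n * z ^ n =
      (tw.map fun dc => (dc.2 : ℝ) * ∑' m : ℕ, (χ ((m : ℕ) : ZMod q)).re * (z ^ dc.1) ^ m).sum
  | [], _ => by simp [rwSeq]
  | dc :: rest, h => by
    have hdc : 1 ≤ dc.1 := h dc (by simp)
    have hrest : ∀ dc' ∈ rest, 1 ≤ dc'.1 := fun dc' h' ↦ h dc' (List.mem_cons_of_mem _ h')
    have hsplit : ∀ n, rwSeq χ (dc :: rest) n * z ^ n = termZ χ z dc n + rwSeq χ rest n * z ^ n := by
      intro n; simp only [rwSeq, List.map_cons, List.sum_cons, termZ]; ring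
    rw [tsum_congr hsplit, (summable_termZ χ hz0 hz1 dc).tsum_add (summable_rwSeq_mul_pow χ hz0 hz1 rest),
      tsum_termZ χ dc hdc, tsum_rwSeq_mul_pow hz0 hz1 rest hrest, List.map_cons, List.sum_cons]

/-! ### The dilated Laplace integrals -/

omit [NeZero q] in
/-- Pointwise: `t^{σ−1} P_χ(e^{−dt}) = d^{1−σ}·((dt)^{σ−1} P_χ(e^{−dt}))` for `t > 0`. [folklore] -/
private theorem dilate_pt {σ : ℝ} {d : ℕ} (hd : 1 ≤ d) {t : ℝ} (ht : t ∈ Ioi (0 : ℝ)) :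
    t ^ (σ - 1) * ∑' m : ℕ, (χ ((m : ℕ) : ZMod q)).re * (Real.exp (-t) ^ d) ^ m =
      (d : ℝ) ^ (1 - σ) * ((d * t) ^ (σ - 1) * ∑' m : ℕ, (χ ((m : ℕ) : ZMod q)).re * Real.exp (-(d * t)) ^ m) := by
  have hd0 : (0 : ℝ) < d := by exact_mod_cast hd
  have ht0 : 0 < t := ht
  have hexp : Real.exp (-t) ^ d = Real.exp (-(d * t)) := by
    rw [← Real.exp_nat_mul]; ring_nf
  have hd1 : (d : ℝ) ^ (1 - σ) * (d : ℝ) ^ (σ - 1) = 1 := by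
    rw [← Real.rpow_add hd0]; norm_num
  rw [hexp, Real.mul_rpow hd0.le ht0.le]
  set S := ∑' m : ℕ, (χ ((m : ℕ) : ZMod q)).re * Real.exp (-(d * t)) ^ m
  calc t ^ (σ - 1) * S = ((d : ℝ) ^ (1 - σ) * (d : ℝ) ^ (σ - 1)) * (t ^ (σ - 1) * S) := by rw [hd1, one_mul]
    _ = (d : ℝ) ^ (1 - σ) * ((d : ℝ) ^ (σ - 1) * t ^ (σ - 1) * S) := by ring

/-- `∫₀^∞ t^{σ−1} P_χ(e^{−dt}) dt = d^{−σ}·Γ(σ)·ℜL(σ, χ)` (`d ≥ 1`, `σ > 0`): substitution `u = dt` in MV (5.23).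
[cite: MontgomeryVaughan2007, §5.1 eq. (5.23)] -/
theorem integral_dilated (hχ : χ ≠ 1) {σ : ℝ} (hσ : 0 < σ) {d : ℕ} (hd : 1 ≤ d) :
    ∫ t in Ioi (0 : ℝ), t ^ (σ - 1) * ∑' m : ℕ, (χ ((m : ℕ) : ZMod q)).re * (Real.exp (-t) ^ d) ^ m =
      (d : ℝ) ^ (-σ) * (Real.Gamma σ * (χ.LFunction (σ : ℂ)).re) := by
  have hd0 : (0 : ℝ) < d := by exact_mod_cast hd
  set h : ℝ → ℝ := fun u ↦ u ^ (σ - 1) * ∑' m : ℕ, (χ ((m : ℕ) : ZMod q)).re * Real.exp (-u) ^ m with hh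
  have hint : ∫ u in Ioi (0 : ℝ), h u = Real.Gamma σ * (χ.LFunction (σ : ℂ)).re := by
    rw [hh, Gamma_mul_re_LFunction_eq_integral χ hχ hσ]
  -- the integrand is `d^{1−σ} · h(d t)` on `t > 0`
  have hpt : EqOn (fun t : ℝ ↦ t ^ (σ - 1) * ∑' m : ℕ, (χ ((m : ℕ) : ZMod q)).re * (Real.exp (-t) ^ d) ^ m)
      (fun t ↦ (d : ℝ) ^ (1 - σ) * h (d * t)) (Ioi (0 : ℝ)) := fun t ht ↦ dilate_pt χ hd ht
  rw [setIntegral_congr_fun measurableSet_Ioi hpt, integral_const_mul,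
    integral_comp_mul_left_Ioi h 0 hd0, mul_zero, hint, smul_eq_mul, ← mul_assoc]
  congr 1
  rw [show (d : ℝ) ^ (-σ) = (d : ℝ) ^ (1 - σ) * (d : ℝ)⁻¹ from by
    rw [← Real.rpow_neg_one, ← Real.rpow_add hd0]; ring_nf]

/-- Integrability of the dilated integrand on `(0, ∞)`. [cite: MontgomeryVaughan2007, §5.1 eq. (5.23)] -/
theorem integrableOn_dilated (hχ : χ ≠ 1) {σ : ℝ} (hσ : 0 < σ) {d : ℕ} (hd : 1 ≤ d) :
    IntegrableOn (fun t : ℝ ↦ t ^ (σ - 1) * ∑' m : ℕ, (χ ((m : ℕ) : ZMod q)).re * (Real.exp (-t) ^ d) ^ m)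
      (Ioi 0) := by
  have hd0 : (0 : ℝ) < d := by exact_mod_cast hd
  set h : ℝ → ℝ := fun u ↦ u ^ (σ - 1) * ∑' m : ℕ, (χ ((m : ℕ) : ZMod q)).re * Real.exp (-u) ^ m with hh
  have hh_int : IntegrableOn h (Ioi 0) := by
    rw [hh]
    exact integrableOn_rpow_mul_powerSeries _ (re_apply_natCast_zero χ hχ) (abs_re_apply_natCast_le χ)
      (abs_summatory_re_le χ hχ) hσ
  have hcomp : IntegrableOn (fun t : ℝ ↦ h (d * t)) (Ioi 0) := by
    rw [integrableOn_Ioi_comp_mul_left_iff h 0 hd0, mul_zero]; exact hh_int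
  have h2 : IntegrableOn (fun t : ℝ ↦ (d : ℝ) ^ (1 - σ) * h (d * t)) (Ioi 0) := hcomp.const_mul _
  exact h2.congr_fun (fun t ht ↦ (dilate_pt χ hd ht).symm) measurableSet_Ioi

/-- `∫₀^∞ t^{σ−1} Σ_{(d,c)} c P_χ(e^{−dt}) dt = Γ(σ)·G(σ)·ℜL(σ, χ)`. [cite: MontgomeryVaughan2007, §5.1 eq. (5.23)] -/
theorem integral_combination (hχ : χ ≠ 1) {σ : ℝ} (hσ : 0 < σ) :
    ∀ tw : List (ℕ × ℤ), (∀ dc ∈ tw, 1 ≤ dc.1) →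
    IntegrableOn (fun t : ℝ ↦ t ^ (σ - 1) *
        (tw.map fun dc => (dc.2 : ℝ) * ∑' m : ℕ, (χ ((m : ℕ) : ZMod q)).re * (Real.exp (-t) ^ dc.1) ^ m).sum) (Ioi 0) ∧
    ∫ t in Ioi (0 : ℝ), t ^ (σ - 1) *
        (tw.map fun dc => (dc.2 : ℝ) * ∑' m : ℕ, (χ ((m : ℕ) : ZMod q)).re * (Real.exp (-t) ^ dc.1) ^ m).sum =
      Real.Gamma σ * rwG tw σ * (χ.LFunction (σ : ℂ)).re
  | [], _ => by simp [rwG]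
  | dc :: rest, h => by
    have hdc : 1 ≤ dc.1 := h dc (by simp)
    obtain ⟨ih_int, ih_eq⟩ := integral_combination hχ hσ rest fun dc' h' ↦ h dc' (by simp [h'])
    have hterm_int := (integrableOn_dilated χ hχ hσ hdc).const_mul (dc.2 : ℝ)
    have hsplit : (fun t : ℝ ↦ t ^ (σ - 1) *
        ((dc :: rest).map fun dc => (dc.2 : ℝ) * ∑' m : ℕ, (χ ((m : ℕ) : ZMod q)).re * (Real.exp (-t) ^ dc.1) ^ m).sum) =
        fun t ↦ (dc.2 : ℝ) * (t ^ (σ - 1) * ∑' m : ℕ, (χ ((m : ℕ) : ZMod q)).re * (Real.exp (-t) ^ dc.1) ^ m) +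
          t ^ (σ - 1) * (rest.map fun dc => (dc.2 : ℝ) * ∑' m : ℕ, (χ ((m : ℕ) : ZMod q)).re * (Real.exp (-t) ^ dc.1) ^ m).sum := by
      funext t; simp only [List.map_cons, List.sum_cons]; ring
    rw [hsplit]
    refine ⟨hterm_int.add ih_int, ?_⟩
    rw [integral_add hterm_int ih_int, integral_const_mul, integral_dilated χ hχ hσ hdc, ih_eq, rwG, rwG,
      List.map_cons, List.sum_cons]
    ring

/-! ### The criterion -/

/-- **Fekete–Pólya with a positive Euler-type reweighting.** `χ ≠ χ₀` mod `q`, `σ > 0`, a finite list of pairs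
`(d, c_d)` with `d ≥ 1` and `G(σ) = Σ c_d d^{−σ} > 0`, `a = rwSeq χ tw` bounded by `C`, with `a(1) > 0`, bounded
summatory function and `S_k(N, a) ≥ 0` for all `N ≥ 1`: then `ℜL(σ, χ) > 0`.
[cite: MontgomeryVaughan2007, §11.2.1 Exercises 7 (g), 8] -/
theorem re_LFunction_pos_of_reweighted (hχ : χ ≠ 1) (tw : List (ℕ × ℤ)) (htw : ∀ dc ∈ tw, 1 ≤ dc.1)
    {σ : ℝ} (hσ : 0 < σ) (hG : 0 < rwG tw σ) {C : ℝ} (hC : ∀ n, |rwSeq χ tw n| ≤ C)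
    (h1 : 0 < rwSeq χ tw 1) {B : ℝ} (hB : ∀ N, |summatory (rwSeq χ tw) N| ≤ B)
    {k : ℕ} (hk : ∀ N, 1 ≤ N → 0 ≤ iterSummatory (rwSeq χ tw) k N) :
    0 < (χ.LFunction (σ : ℂ)).re := by
  set C' : ℝ := max C 1 with hC'
  have hC'0 : 0 < C' := lt_of_lt_of_le one_pos (le_max_right _ _)
  set f : ℕ → ℝ := fun n ↦ rwSeq χ tw n / C' with hf
  have hf0 : f 0 = 0 := by
    have : rwSeq χ tw 0 = 0 := by
      have h0 := re_apply_natCast_zero χ hχ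
      unfold rwSeq
      rw [List.sum_eq_zero]
      intro x hx
      rw [List.mem_map] at hx
      obtain ⟨dc, -, rfl⟩ := hx
      simp only [Nat.zero_div, dvd_zero, if_true, h0, mul_zero]
    simp [hf, this]
  have hfle : ∀ n, |f n| ≤ 1 := fun n ↦ by
    rw [hf, abs_div, abs_of_pos hC'0, div_le_one hC'0]
    exact (hC n).trans (le_max_left _ _)
  have hf1 : 0 < f 1 := div_pos h1 hC'0
  have hfB : ∀ N, |summatory f N| ≤ B / C' := fun N ↦ by
    rw [hf, summatory_div, abs_div, abs_of_pos hC'0]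
    exact div_le_div_of_nonneg_right (hB N) hC'0.le
  have hfk : ∀ N, 1 ≤ N → 0 ≤ iterSummatory f k N := fun N hN ↦ by
    rw [hf, iterSummatory_div]; exact div_nonneg (hk N hN) hC'0.le
  have hpos := integral_rpow_mul_powerSeries_pos f hf0 hfle hf1 hfB hfk hσ
  -- identify the integrand with the finite combination of dilated series
  have hP : ∀ t ∈ Ioi (0 : ℝ), t ^ (σ - 1) * ∑' n, f n * Real.exp (-t) ^ n =
      C'⁻¹ * (t ^ (σ - 1) *
        (tw.map fun dc => (dc.2 : ℝ) * ∑' m : ℕ, (χ ((m : ℕ) : ZMod q)).re * (Real.exp (-t) ^ dc.1) ^ m).sum) := by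
    intro t ht
    have ht0 : 0 < t := ht
    have hz0 : 0 ≤ Real.exp (-t) := (Real.exp_pos _).le
    have hz1 : Real.exp (-t) < 1 := Real.exp_lt_one_iff.2 (by linarith)
    have : ∑' n, f n * Real.exp (-t) ^ n = C'⁻¹ * ∑' n, rwSeq χ tw n * Real.exp (-t) ^ n := by
      rw [← tsum_mul_left]; exact tsum_congr fun n ↦ by rw [hf]; ring
    rw [this, tsum_rwSeq_mul_pow χ hz0 hz1 tw htw]; ring
  obtain ⟨-, hI⟩ := integral_combination χ hχ hσ tw htw
  rw [setIntegral_congr_fun measurableSet_Ioi hP, integral_const_mul, hI] at hpos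
  have hΓ := Real.Gamma_pos_of_pos hσ
  have h2 : 0 < Real.Gamma σ * rwG tw σ * (χ.LFunction (σ : ℂ)).re :=
    pos_of_mul_pos_right hpos (inv_nonneg.2 hC'0.le)
  exact pos_of_mul_pos_right h2 (mul_pos hΓ hG).le

/-- Non-vanishing form: under the same hypotheses `L(σ, χ) ≠ 0`. [cite: MontgomeryVaughan2007, §11.2.1 Exercises 7 (g), 8] -/
theorem lfunction_ne_zero_of_reweighted (hχ : χ ≠ 1) (tw : List (ℕ × ℤ)) (htw : ∀ dc ∈ tw, 1 ≤ dc.1)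
    {σ : ℝ} (hσ : 0 < σ) (hG : 0 < rwG tw σ) {C : ℝ} (hC : ∀ n, |rwSeq χ tw n| ≤ C)
    (h1 : 0 < rwSeq χ tw 1) {B : ℝ} (hB : ∀ N, |summatory (rwSeq χ tw) N| ≤ B)
    {k : ℕ} (hk : ∀ N, 1 ≤ N → 0 ≤ iterSummatory (rwSeq χ tw) k N) : χ.LFunction (σ : ℂ) ≠ 0 := by
  intro h0
  have := re_LFunction_pos_of_reweighted χ hχ tw htw hσ hG hC h1 hB hk
  rw [h0, Complex.zero_re] at this
  exact lt_irrefl _ this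

end FeketePolyaReweighted

end Literature.NumberTheory.LFunctions
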